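import Summits.Langlands.Langlands.Theorems.SoloInformedFontaineMazurGL1General
import Literature.NumberTheory.PAdicHodge.LubinTateCharacterConjugatesDegreeTwo
import HarnessLib

/-!
# SoloInformedDeRhamGL1QuadraticRamified — de Rham ⇒ locally algebraic for rank-one `p`-adic
# representations of `Γ_F`, `F/ℚ_p` totally ramified QUADRATIC (solo-Langlands-informed s111, Stage E1)

`SoloInformedFontaineMazurGL1General.exists_isOpen_eq_prod_of_isDeRhamFramed_general` proves Tate's
theorem for every finite `F/ℚ_p` GRANTING the Literature hypothesis
(H) = `LubinTateCharacterConjugateAdmissible F p hp hπ`.  The Literature theorem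
`lubinTateCharacterConjugateAdmissible_of_finrank_eq_two` (Lubin–Tate period `Ω = θ(t_π/t) ∈ ℂ_F` built in
`A_inf(𝒪_D)`/`B_dR⁺`, plus the unramified period of `N(χ_π)/χ`) DISCHARGES (H) when `F/ℚ_p` is totally
ramified of degree `2`, `p ≥ 3`, and the uniformizer `π` is the root of an Eisenstein datum `D`.  Hence:

★ `exists_isOpen_eq_prod_of_isDeRhamFramed_quadratic` — for such `F`, every de Rham framed character
`r : Γ_F → GL₁(ℚ̄_p)` is locally algebraic: `r(w) = ∏_e e(Art_F w)^{n_e}` on an open subgroup of inertia.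

This is the first case of the rank-one local-algebraicity theorem in the tree beyond `e(F/ℚ_p) = 1`
(`DeRhamRankOne.exists_isOpen_eq_prod_of_isDeRhamFramed` needs `π = p`, `q = p`).

References: J.-P. Serre, *Abelian ℓ-adic representations and elliptic curves* (1968), Ch. III App. A
[SerreAbelianLadic1968]; J. Tate, *p-divisible groups* (1967), §3.3 [Tate1967]; P. Colmez, Ann. of
Math. 138 (1993) §I.2 [Colmez1993].
-/

noncomputable section

open ValuativeRel
open scoped MatrixGroups

namespace Summit.Langlands.Langlands.Theorems

open Literature.NumberTheory.PAdicHodge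
open Literature.NumberTheory.GaloisRepresentations
open Literature.NumberTheory.GaloisRepresentations.IsNonarchimedeanLocalField
open Literature.NumberTheory.LocalFields
open Field

/-- ★ **Tate's theorem (de Rham ⇒ locally algebraic) for rank one over a totally ramified quadratic
`F/ℚ_p`, `p ≥ 3` — unconditionally.** Hypotheses: an Eisenstein datum `D` of `F` whose root is the
uniformizer `π`, `#k_F = p`, `[F : ℚ_p] = 2`.
[cite: SerreAbelianLadic1968, Ch. III §A.5–A.7] [cite: Tate1967, §3.3 Thm. 2 and Cor. 2] [cite: Colmez1993, §I.2] -/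
theorem exists_isOpen_eq_prod_of_isDeRhamFramed_quadratic
    {F : Type} [Field F] [ValuativeRel F] [TopologicalSpace F] [IsNonarchimedeanLocalField F]
    [CharZero F] {p : ℕ} [Fact p.Prime] (hp : valuation F p < 1) (D : EisensteinRoot F p hp)
    {π : 𝒪[F]} (hπ : (valuation F).IsUniformizer (π : F)) (hπD : (π : F) = D.root)
    (hk : residueFieldCard F = p) (hp3 : 3 ≤ p) (h2 : Module.finrank (PadicBase F p hp) F = 2)
    (r : FramedRep (absoluteGaloisGroup F) (PadicAlgCl p) 1)
    (hr : (fontainePst F p hp).IsDeRhamFramed r) :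
    ∃ V : Subgroup Fˣ, IsOpen (V : Set Fˣ) ∧
      ∃ (s : Finset (F →+* PadicAlgCl p)) (n : (F →+* PadicAlgCl p) → ℤ),
        (∀ e ∈ s, Continuous e) ∧ ∀ w ∈ WeilGroup.inertia F, canonicalArtin F w ∈ V →
          ((r (WeilGroup.toAbsGalois F w) : GL (Fin 1) (PadicAlgCl p)) :
              Matrix (Fin 1) (Fin 1) (PadicAlgCl p)) 0 0 =
            ∏ e ∈ s, e ((canonicalArtin F w : Fˣ) : F) ^ n e :=
  exists_isOpen_eq_prod_of_isDeRhamFramed_general hp hπ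
    (lubinTateCharacterConjugateAdmissible_of_finrank_eq_two hp D hπ hπD hk hp3 h2) r hr

end Summit.Langlands.Langlands.Theorems

end
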